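import Summits.BirchSwinnertonDyer.BirchSwinnertonDyer.Theses.UniversalToricDescent
import Summits.BirchSwinnertonDyer.BirchSwinnertonDyer.Theorems.UniversalToricDescentTwinAlgMuZeroAtThreeOfBetaRoadParam
import Summits.BirchSwinnertonDyer.BirchSwinnertonDyer.Theorems.UniversalToricDescentBetaRoadParamDefs
import Summits.BirchSwinnertonDyer.BirchSwinnertonDyer.Theorems.UniversalToricDescentAcDualMuZeroCriterion
import Literature.NumberTheory.EllipticCurves.Newforms
import Literature.NumberTheory.EllipticCurves.CuspFormLFunction
import Literature.FieldTheory.AlgClosed.PadicAlgClEquivComplex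
import HarnessLib

/-!
# Crux r205 `TwinAlgMuZeroAtThree` (stmt-BirchSwinnertonDyer-24737) — node `wild-ordinary-avatar` (crux-ideate STANDING COVER g26, 2026-08-31)

NOT the LEAD skeleton (`Lines/beta_road.lean` v19 stays registered; this file is never `skeleton check`ed).  A D-0171 NODE: compiling,
pieces tagged, `sorry` ONLY inside `stub_*`, composition `TwinAlgMuZeroAtThree_of` concludes the crux BY NAME.

**THE MOVE (change the avatar, keep `ρ̄`; stay at weight 2 over `ℚ`).**  On bucket B (`3 ∥ N′`, `ρ̄ := E′[3]` très ramifié at `3`,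
`ρ̄|G_{ℚ₃} ≅ (ω·u  ∗ ; 0  u)` with `u` unramified, `u² = 1`) the twin `E′` is a Tate curve at `𝔭, 𝔭′ ∣ 3`.  Replace it by the
**weight-2 wild-character member `g′` of its own `3`-adic Hida family**: `g′ ∈ S₂(Γ₁(3N′) = Γ₁(9M′), χ)`, `χ` the Dirichlet
character of conductor `9` and order `3` (`χ ≡ 1 (mod λ)`, `λ = 1 − ζ₃`), `ρ̄_{g′} ≅ ρ̄`, and `g′` **`3`-ORDINARY**: `a₃(g′) = α` a
`λ`-adic unit with `|α|_∞ = √3`.  Its local Galois type at `3` is the wild principal series `(ψε·unr  ∗ ; 0  unr(α))`,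
`ψ|_{I₃} = η` of order `3`: `A_{g′}` (and the conjugate-self-dual twist `g = g′ ⊗ χ̄`, level `81M′`, trivial character) has
POTENTIALLY GOOD ORDINARY reduction at `3`, good ordinary over the ramified cyclic cubic `L_η/ℚ₃`.
* LOCAL LEMMA (new; Galois cohomology of `G_{ℚ₃}`, `𝒪 = ℤ₃[ζ₃]`): for `ψ ≡ 1 (mod λ)` of order `3` put `φ_ψ := (ψ − 1)/λ mod λ ∈
  Hom(G_{ℚ₃}, 𝔽₃) ∖ 0`.  The image of `H¹(ℚ₃, 𝒪(ψε)) → H¹(ℚ₃, 𝔽₃(ω)) = ℚ₃^×/cubes ≅ ⟨3⟩ × ⟨4⟩` is the LINE `N(L_φ^×) mod cubes`,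
  `L_φ/ℚ₃` the cubic field cut out by `φ_ψ` (obstruction = `φ ∪ [a]`, local class field theory).  Hence the très-ramifié class
  `a = q_{E′} = 3^x 4^y (x ≠ 0)` of `ρ̄|G_{ℚ₃}` lifts to an ORDINARY crystabelline point of type `η ⊕ 1` iff `L_φ` is the ramified
  cubic whose norm line is `𝔽₃·a` — always satisfiable by the choice of the unramified parts (`y = 0 ⇔ L_φ = ℚ₃(ζ₉)⁺`).  On bucket
  C₀ (niveau 2, `a₃ = 0`) weak admissibility forces slopes `(½, ½)`: the avatar is a bucket-B device; C₀ stays C₀′ of `beta-road`.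
* WHY THE AVATAR IS BETTER PLACED THAN `E′` (bucket B):  (i) NON-EXCEPTIONAL: `T_g⁻ = 𝒪(η̄·unr(α))` and `α` is a Weil number of
  absolute value `√3`, so `α^f ≠ 1` for every `f ≥ 1` (`pow_ne_one_of_norm_eq_sqrt_three` below) and `H⁰(K_{∞,𝔭}, A_g⁻)` is FINITE
  for EVERY `K` (the residue field of `K_{∞,𝔭}` is finite) — Greenberg's hypothesis holds, `H²_Iw(K_{∞,𝔭}, F⁺T_g)` is finite,
  anticyclotomic control for `Sel_Gr` has finite error; for the Tate curve `E′` with `a₃(E′) = +1` (or `a₃ = −1` and even residue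
  degree) `H⁰(K_{∞,𝔭}, ℚ₃/ℤ₃) = ℚ₃/ℤ₃` is infinite (exceptional zero).  (ii) WEIGHT 2: honest CM points, no Fontaine–Laffaille
  (row 7 `serre-weight-four-transport` dies at `p > k+1`).  (iii) OVER `ℚ`, no new level primes: the Heegner hypothesis for
  `(81M′, K)` is the crux's own (`3` splits in `K`); CM points of conductor `3ⁿ` (`n ≥ 2`) with the vertical `Γ_χ(9)`-structure live
  on `X_χ(9M′)` over `K[3ⁿ]·ℚ(ζ₉)⁺` and their `χ̄`-isotypic parts are `K[3ⁿ]`-points of `A_g` (diamond = nebentypus); `U₃` acts on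
  them through `a₃(g′) = α` (a UNIT), so `zₙ := α⁻ⁿ·yₙ` is norm-compatible — the trace-zero phenomenon (`a₃(g) = 0` for the self-dual
  NEWFORM `g` of level `81M′`) is a test-vector artefact and does not bite (row 15 `ramified-flattening-transport` instead needs Hsieh
  over a cubic field with `3` ramified — blocked; row 19 `steinberg-line-descent` needs Howard 2007 big Heegner points at `p ∤ 6N`).
  (iv) the `Λ`-adic Kolyvagin-system argument for `(T_g, Gr)` is Howard-2004-shaped (Greenberg-ordinary, `p`-distinguished since
  `ω ≠ 1`, conjugate-self-dual) except for the CM-point level structure at `3`; the analytic `μ = 0` is Hsieh Thm B at any level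
  (`(π_{g′}, λ)` with `λ|_{𝔸_ℚ^×} = χ̄`, `𝔫⁻ = 1`, `𝔠_λ⁻ = 1`); the value formula at finite-order characters is the `p ∣ N` `p`-adic
  Waldspurger formula (Liu–Zhang–Zhang).
* AVATAR FREEDOM PER RESIDUAL PIECE: crux_B ⟺ `Sel_(∅,0)(K_∞, ρ̄)` is `Ω`-cotorsion (`Ω = 𝔽₃⟦T⟧`; route receptacle + its converse),
  and the conditions `∅`/`0` above `3` do not see the lift; so every piece of a proof may be run on whichever modular lift of `ρ̄` is
  convenient: the local `λ`-indivisibility of Heegner classes (LEAD's K1‴) is INSTRUMENTED on `E′` (PARI) and transferred to `g′` by the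
  triangular ordinary-stabilisation relation between the two CM-divisor families in `J_χ(9M′)_𝔪` (mod-`3` multiplicity one), while the
  `Λ`-adic upper bound (LEAD's K2a‴) is run on the non-exceptional avatar.
* HONEST LIMITS: the RESIDUAL anomaly (`u = 1`, split-type twins) is a property of `ρ̄` and is shared by every avatar; `W-K2(g)` (the
  Howard-type `Λ`-adic Kolyvagin system for a weight-2 form with `p² ∣ N` and nebentypus at `p = 3`) is UNPRINTED (research, but the
  generic ordinary case); instrumenting `A_g` directly is impractical (dimension ≥ 4) — use avatar freedom.

**PIECES AND TAGS.**
* §1 `WildOrdinaryAvatarExists` (W-EXIST) — every bucket-B twin has a `3`-ordinary newform `g′ ∈ S₂(Γ₁(3N′))` with nebentypus of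
  order `3` and conductor `∣ 9`, congruent to `E′` at all `ℓ ∤ 3N′` under some `ι′ : ℚ̄₃ ≅ ℂ`.  TAG: UNDECIDED, independent of the crux ·
  ATTACKABLE (print-adjacent: Hida's control/freeness of the ordinary part in weight 2 across the wild characters of `Γ₁(9)` — in print
  for `p ≥ 5`, and at `p = 3` under `p^r > 3` [Hida 2000, Thm 3.15, Cor. 3.20: `N′` square-free there]; or Carayol's lemma + the
  ordinary component of the Gee–Kisin Breuil–Mézard count + Kisin's `p = 3` lifting with `ρ̄|G_{ℚ(√−3)}` irreducible) · INSTRUMENTABLE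
  (F-g26-WILD: `15a1`, level `45`, character orbit of conductor `9`: a newform `≡ 15a1 (mod λ)` with `v_λ(a₃) = 0` for some `λ ∣ 3` of
  its coefficient field — which must then have ≥ 2 primes over `3`, since `a₃·ā₃ = 3`).
* §1 `WildOrdinaryAvatarEngine` (W-ENGINE) — bucket-B binders + an avatar ⟹ `Sel_(∅,0)(K_∞, E′[3^∞])[3]` finite.  TAG: WEAKER than
  the crux (PROVED `wildOrdinaryAvatarEngine_of_crux`) · UNDECIDED · leaves: W-TR (residual transfer `E′ ↔ g`, ATTACKABLE S/M: `A_g[λ] ≅ ρ̄`,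
  conditions above `3` identical, finitely many finitely-decomposed `w ∣ M′` contribute finite `H¹(K_{∞,w}, ρ̄)`), W-K1 (= K1‴_res, shared
  with the LEAD, INSTRUMENTABLE on `E′`), W-K2(g) (RESEARCH/ATTACKABLE: Howard 2004 §2–3 port to `(T_g, Gr)` with `χ̄`-isotypic CM points
  of conductor `3ⁿ`, `n ≥ 2`), W-CV(g) (Cornut–Vatsal for `g`, print-adjacent), W-AN(g) (Hsieh Thm B + LZZ, print/print-adjacent).
* C₀′ `TwinAlgMuZeroAtThreeGoodSSOfParam` BY NAME (`stub_goodSS` of `beta-road` v19) — untouched.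
**Composition** `TwinAlgMuZeroAtThree_of : W-EXIST → W-ENGINE → C₀′ → crux`, bucket B through the route receptacle
`isTorsion_and_exists_generator_of_finite_pTorsion`; no `sorry` outside the three `stub_*`.
**Disproof used.** `Disproof.lean` (2026-08-29, NO KILL): the Heegner hypothesis is load-bearing (near-miss `15a1/ℚ(√−23)`, definite) —
honoured: W-K2(g)/W-AN(g) use CM points on `X_χ(9M′)` and Hsieh's `𝔫⁻ = 1`, both exactly `SatisfiesHeegnerHypothesis N′ K` with `3` split;
`HasSurjectiveModNGaloisRep 3` is consumed as `ρ̄` irreducible (Hsieh B (2), Howard's image hypothesis, `A_g(K_∞)[λ] = 0`) and by W-EXIST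
(`ρ̄|G_{ℚ(√−3)}` irreducible for the `p = 3` lifting route); the bucket guard `¬ 3 ∣ v₃(Δ′)` (très ramifié) is exactly the hypothesis of the
LOCAL LEMMA; `Odd d_K` and `Dt′` are not used by the avatar pieces (consistent with `Negative/GuardCuts.lean`; `Dt′` is threaded, vet flag
`ground.unused-binder` notwithstanding).  Habitats `15a1/ℚ(√−11)` (B) and `17a1/ℚ(√−19)` (C₀) are instances of no stub's negation; negatives
24881 / 15532 unrelated.
-/

noncomputable section

open scoped Classical NumberField

set_option linter.dupNamespace false
set_option autoImplicit false

/-! ## §0 Instrument (sorry-free): Weil numbers of absolute value `√3` are never roots of unity -/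

namespace Summit.BirchSwinnertonDyer.BirchSwinnertonDyer.Cruxes.TwinAlgMuZeroAtThree.WildOrdinaryAvatar.Instrument

/-- **Non-exceptionality of the avatar's unit root.**  If `‖α‖ = √3` then `α ^ f ≠ 1` for every `f ≠ 0`: the unramified quotient
character `unr(α)` of the wild-ordinary avatar is non-trivial on every open subgroup of `G_{ℚ₃}` of finite residue degree, so
`H⁰(K_{∞,𝔭}, A_g⁻)` is finite for every `K` — in contrast with the Tate curve (`α = a₃(E′) = ±1`). [folklore] -/
theorem pow_ne_one_of_norm_eq_sqrt_three {α : ℂ} (h : ‖α‖ = Real.sqrt 3) {f : ℕ} (hf : f ≠ 0) : α ^ f ≠ 1 := by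
  intro h1
  have hn : ‖α ^ f‖ = 1 := by rw [h1, norm_one]
  rw [norm_pow, h] at hn
  have h3 : (1 : ℝ) < Real.sqrt 3 := by
    rw [show (1 : ℝ) = Real.sqrt 1 by simp]
    exact Real.sqrt_lt_sqrt (by norm_num) (by norm_num)
  have := one_lt_pow₀ h3 hf
  linarith

/-- The same for any absolute value `> 1` (e.g. `√p`, weight-`2` unit roots at any `p`). [folklore] -/
theorem pow_ne_one_of_one_lt_norm {α : ℂ} (h : 1 < ‖α‖) {f : ℕ} (hf : f ≠ 0) : α ^ f ≠ 1 := by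
  intro h1
  have hn : ‖α ^ f‖ = 1 := by rw [h1, norm_one]
  rw [norm_pow] at hn
  have := one_lt_pow₀ h hf
  linarith

end Summit.BirchSwinnertonDyer.BirchSwinnertonDyer.Cruxes.TwinAlgMuZeroAtThree.WildOrdinaryAvatar.Instrument

namespace Summit.BirchSwinnertonDyer.BirchSwinnertonDyer.Cruxes.TwinAlgMuZeroAtThree.WildOrdinaryAvatar

open NumberField IsDedekindDomain Field WeierstrassCurve
open Literature.NumberTheory.EllipticCurves Literature.NumberTheory.EllipticCurves.IwasawaAlgebra
open Literature.NumberTheory.EllipticCurves.ZpExtension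
open Literature.NumberTheory.EllipticCurves.ModularForms
open Summit.BirchSwinnertonDyer.Rank1Residual.X11b Summit.BirchSwinnertonDyer.Rank1Residual.X11b.AcSelmer
open Summit.BirchSwinnertonDyer.BirchSwinnertonDyer.Theorems
open Summit.BirchSwinnertonDyer.BirchSwinnertonDyer.Theorems.UniversalToricDescentAcDualMuZero
open CongruenceSubgroup

/-! ## §1 The avatar and the two pieces -/

/-- **`(g′, ι′)` is a wild-type `3`-ordinary avatar of `W′` at level `3N′`.**  `g′ ∈ S₂(Γ₁(3N′))` is a newform (Diamond–Shurman 5.8.1)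
whose nebentypus `χ` satisfies `χ³ = 1`, `χ ≠ 1`, `cond χ ∣ 9` (hence `cond χ = 9`, `χ` of order `3`: the wild character); under
`ι′ : ℚ̄₃ ≅ ℂ` its `3`-rd coefficient is a `3`-adic UNIT (ordinarity: `π₃(g′)` is the principal series `PS(ψ·unr, unr(α))`, `a₃(g′) = α`),
and `a_ℓ(g′) ≡ a_ℓ(W′)` in the maximal ideal of `ℤ̄₃` for every prime `ℓ ∤ 3N′` (so `ρ̄_{g′,ι′} ≅ W′[3]` when the latter is irreducible).
(ordinary parts across the characters of `Γ₁(p^r)`, `p^r > 3`). [cite: Hida2000, Thm. 3.15, Cor. 3.20 (shape)] -/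
def IsWildOrdinaryAvatarAtThree (W' : WeierstrassCurve ℚ) [W'.IsGloballyMinimal] (N' : ℕ) [NeZero N']
    (g : CuspForm (Gamma1 (3 * N')) 2) (ι' : PadicAlgCl 3 ≃+* ℂ) : Prop :=
  haveI : NeZero (3 * N') := ⟨mul_ne_zero three_ne_zero (NeZero.ne N')⟩
  IsNewform1 g ∧ (nebentypus g) ^ 3 = 1 ∧ nebentypus g ≠ 1 ∧ (nebentypus g).conductor ∣ 9 ∧
    ‖ι'.symm (cuspCoeff g 3)‖ = 1 ∧
    ∀ ℓ : ℕ, ℓ.Prime → ¬ ℓ ∣ 3 * N' → ‖ι'.symm (cuspCoeff g ℓ - (W'.frobeniusTrace ℓ : ℂ))‖ < 1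

/-- **W-EXIST — every bucket-B twin has a wild-type ordinary avatar.**  For `W′` with multiplicative, très ramifié reduction at `3`
(`3 ∥ N′`, `3 ∤ v₃(Δ′)`) and `ρ̄₃` onto `GL₂(𝔽₃)`: the weight-2 specialisation of `W′`'s `3`-adic Hida family (tame level `M′ = N′/3`)
at the wild character of conductor `9` is a `3`-ordinary newform of level `3N′ = 9M′` congruent to `W′`.  TAG: UNDECIDED (independent of
the crux) · ATTACKABLE (Hida control at `p = 3` with `Γ₁(9)`-structure; or Carayol + Gee–Kisin ordinary component + Kisin `p = 3`) ·
INSTRUMENTABLE (F-g26-WILD at level `45`).  Why it might fail: `p = 3` pathologies of Hida control for non-square-free `M′` are not in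
print; the local lemma guarantees ordinary lifts of the very type, the global form must come from control/lifting.
[cite: Hida2000, Thm. 3.15, Cor. 3.20] [cite: GeeKisin2014, Thm. A (shape)] [cite: Carayol1989, Lemme 1 (shape)] [cite: Gee2011PrescribedTypes, Thm. 5.2.1 (shape)] -/
@[conjecture]
def WildOrdinaryAvatarExists : Prop :=
    ∀ (W' : WeierstrassCurve ℚ) [W'.IsElliptic] [W'.IsGloballyMinimal] (N' : ℕ) [NeZero N'],
      Rank1Residual.Mult W' 3 → ¬ 3 ∣ padicValInt 3 W'.minimalDiscriminantInt →
      W'.HasSurjectiveModNGaloisRep 3 → W'.conductorNorm ℤ = N' →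
      ∃ (g : CuspForm (Gamma1 (3 * N')) 2) (ι' : PadicAlgCl 3 ≃+* ℂ), IsWildOrdinaryAvatarAtThree W' N' g ι'

/-- **W-ENGINE — the avatar engine (bucket B, the crux's binders verbatim + an avatar) ⟹ `Sel_𝔭′(K_∞, E′[3^∞])[3]` finite.**
The research content is «`X_(∅,0)(A_g/K_∞)_λ` is `Λ_𝒪`-torsion with `μ = 0`» for the conjugate-self-dual twist `g = g′ ⊗ χ̄`
(pot. good ORDINARY at `3`, Greenberg non-exceptional for every `K`), by the Howard-type `Λ`-adic Kolyvagin system of `χ̄`-isotypic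
CM points on `X_χ(9M′)` (unit `U₃`-eigenvalue: norm-compatible, no trace-zero) + Cornut–Vatsal + Hsieh Thm B / LZZ on the analytic
side, followed by the residual transfer `A_g[λ] ≅ ρ̄ ≅ E′[3]` for the `(∅,0)` conditions (identical above `3`; finite local terms at the
finitely many finitely-decomposed `w ∣ M′`).  TAG: WEAKER than the crux (`wildOrdinaryAvatarEngine_of_crux`) · UNDECIDED · leaves W-TR
(ATTACKABLE), W-K1 (= K1‴_res, INSTRUMENTABLE on `E′`), W-K2(g) (RESEARCH/ATTACKABLE), W-CV(g), W-AN(g) (print/print-adjacent).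
[cite: Howard2004HeegnerKolyvagin, Thm. 2.2.10, §3.3 (shape)] [cite: GreenbergVatsal2000, Prop. 2.8 (shape)]
[cite: Hsieh2014, Thm. B] [cite: CornutVatsal2005, Thm. 1.10 (shape)] -/
@[conjecture]
def WildOrdinaryAvatarEngine : Prop :=
    ∀ (W' : WeierstrassCurve ℚ) [W'.IsElliptic] [W'.IsGloballyMinimal] (N' : ℕ) [NeZero N']
      (K : Type) [Field K] [NumberField K] (_Dt' : ModularParametrizationData W' N'),
      Rank1Residual.Mult W' 3 → ¬ 3 ∣ padicValInt 3 W'.minimalDiscriminantInt →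
      W'.HasSurjectiveModNGaloisRep 3 → W'.conductorNorm ℤ = N' → IsImaginaryQuadratic K →
      SatisfiesHeegnerHypothesis N' K → Odd (NumberField.discr K) →
      ∀ (κ : ZpExtension K 3), κ.IsAnticyclotomic →
      ∀ (γ : absoluteGaloisGroup K) [Fact (κ.IsTopGenerator γ)]
        (𝔭 : HeightOneSpectrum (𝓞 K)), ((3 : ℕ) : 𝓞 K) ∈ 𝔭.asIdeal →
        𝔭.asIdeal.ramificationIdx (𝓞 ℚ) = 1 → 𝔭.asIdeal.inertiaDeg (𝓞 ℚ) = 1 →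
      ∀ (𝔭' : HeightOneSpectrum (𝓞 K)), ((3 : ℕ) : 𝓞 K) ∈ 𝔭'.asIdeal → 𝔭' ≠ 𝔭 →
      ∀ (g : CuspForm (Gamma1 (3 * N')) 2) (ι' : PadicAlgCl 3 ≃+* ℂ), IsWildOrdinaryAvatarAtThree W' N' g ι' →
      Set.Finite {s : selmerAc (W'.baseChange K) 3 κ 𝔭' ∅ | 3 • s = 0}

/-! ## §2 Evidence for the tags (no `sorry`) -/

/-- **W-ENGINE is WEAKER than the crux**: the crux's bucket-B conclusion already gives the residual finiteness (route converse
`finite_pTorsion_of_isTorsion_of_exists_generator`), whatever the avatar. [folklore] -/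
theorem wildOrdinaryAvatarEngine_of_crux
    (h : Summit.BirchSwinnertonDyer.BirchSwinnertonDyer.Theses.UniversalToricDescent.TwinAlgMuZeroAtThree) :
    WildOrdinaryAvatarEngine := by
  intro W' _ _ N' _ K _ _ Dt' hm htr hsurj hN hK hH hodd κ hκ γ _ 𝔭 h𝔭 he hf 𝔭' h𝔭' hne g ι' _
  obtain ⟨htors, g₀, hg₀, hi⟩ := h W' N' K Dt' (Or.inl ⟨hm, htr⟩) hsurj hN hK hH hodd κ hκ γ 𝔭 h𝔭 he hf 𝔭' h𝔭' hne
  haveI : (W'.baseChange K).IsElliptic := by rw [WeierstrassCurve.baseChange]; infer_instance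
  exact finite_pTorsion_of_isTorsion_of_exists_generator (W'.baseChange K) 3 κ 𝔭' ∅ γ Set.finite_empty htors ⟨g₀, hg₀, hi⟩

/-- **Bookkeeping: W-EXIST ∧ W-ENGINE give the bucket-B residual finiteness** (the avatar is summoned, then discharged). [folklore] -/
theorem residualFinite_mult_of_avatar (hE : WildOrdinaryAvatarExists) (hG : WildOrdinaryAvatarEngine)
    (W' : WeierstrassCurve ℚ) [W'.IsElliptic] [W'.IsGloballyMinimal] (N' : ℕ) [NeZero N']
    (K : Type) [Field K] [NumberField K] (Dt' : ModularParametrizationData W' N')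
    (hm : Rank1Residual.Mult W' 3) (htr : ¬ 3 ∣ padicValInt 3 W'.minimalDiscriminantInt)
    (hsurj : W'.HasSurjectiveModNGaloisRep 3) (hN : W'.conductorNorm ℤ = N') (hK : IsImaginaryQuadratic K)
    (hH : SatisfiesHeegnerHypothesis N' K) (hodd : Odd (NumberField.discr K))
    (κ : ZpExtension K 3) (hκ : κ.IsAnticyclotomic) (γ : absoluteGaloisGroup K) [Fact (κ.IsTopGenerator γ)]
    (𝔭 : HeightOneSpectrum (𝓞 K)) (h𝔭 : ((3 : ℕ) : 𝓞 K) ∈ 𝔭.asIdeal)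
    (he : 𝔭.asIdeal.ramificationIdx (𝓞 ℚ) = 1) (hf : 𝔭.asIdeal.inertiaDeg (𝓞 ℚ) = 1)
    (𝔭' : HeightOneSpectrum (𝓞 K)) (h𝔭' : ((3 : ℕ) : 𝓞 K) ∈ 𝔭'.asIdeal) (hne : 𝔭' ≠ 𝔭) :
    Set.Finite {s : selmerAc (W'.baseChange K) 3 κ 𝔭' ∅ | 3 • s = 0} := by
  obtain ⟨g, ι', hg⟩ := hE W' N' hm htr hsurj hN
  exact hG W' N' K Dt' hm htr hsurj hN hK hH hodd κ hκ γ 𝔭 h𝔭 he hf 𝔭' h𝔭' hne g ι' hg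

/-! ## §3 The three stubs of the node (the ONLY `sorry`s of this file) -/

/-- **stub W-EXIST** — UNDECIDED · ATTACKABLE (print-adjacent) · INSTRUMENTABLE (F-g26-WILD).
[cite: Hida2000, Thm. 3.15, Cor. 3.20] -/
theorem stub_avatarExists : WildOrdinaryAvatarExists := by
  sorry

/-- **stub W-ENGINE** — WEAKER than the crux · UNDECIDED · leaves W-TR / W-K1 / W-K2(g) / W-CV(g) / W-AN(g).
[cite: Howard2004HeegnerKolyvagin, Thm. 2.2.10 (shape)] [cite: Hsieh2014, Thm. B] -/
theorem stub_avatarEngine : WildOrdinaryAvatarEngine := by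
  sorry

/-- **stub C₀′** (`TwinAlgMuZeroAtThreeGoodSSOfParam`) BY NAME — unchanged from line `beta-road` v19 (the avatar is bucket-B only:
on niveau-2 `ρ̄` every weight-2 lift has slopes `(½, ½)`). [cite: Howard2004HeegnerKolyvagin, Thm. B (shape)] -/
theorem stub_goodSS : UniversalToricDescentBetaRoadParamDefs.TwinAlgMuZeroAtThreeGoodSSOfParam := by
  sorry

/-! ## §4 Composition: the crux BY NAME -/

/-- **Crux 24737 `TwinAlgMuZeroAtThree` BY NAME from the node's pieces.**  Bucket B: summon an avatar (W-EXIST), run the engine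
(W-ENGINE) to get `Sel_(∅,0)(K_∞, E′[3^∞])[3]` finite, conclude by the route receptacle
`isTorsion_and_exists_generator_of_finite_pTorsion`.  Bucket C₀: C₀′ BY NAME.  No `sorry` here. -/
theorem TwinAlgMuZeroAtThree_of
    (hE : WildOrdinaryAvatarExists) (hG : WildOrdinaryAvatarEngine)
    (hC0 : UniversalToricDescentBetaRoadParamDefs.TwinAlgMuZeroAtThreeGoodSSOfParam) :
    Summit.BirchSwinnertonDyer.BirchSwinnertonDyer.Theses.UniversalToricDescent.TwinAlgMuZeroAtThree := by
  intro W' _ _ N' _ K _ _ Dt' hbucket hsurj hN hK hH hodd κ hκ γ _ 𝔭 h𝔭 he hf 𝔭' h𝔭' hne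
  rcases hbucket with ⟨hm, htr⟩ | ⟨hss, ha⟩
  · have hfin : Set.Finite {s : selmerAc (W'.baseChange K) 3 κ 𝔭' ∅ | 3 • s = 0} :=
      residualFinite_mult_of_avatar hE hG W' N' K Dt' hm htr hsurj hN hK hH hodd κ hκ γ 𝔭 h𝔭 he hf 𝔭' h𝔭' hne
    haveI : (W'.baseChange K).IsElliptic := by rw [WeierstrassCurve.baseChange]; infer_instance
    exact isTorsion_and_exists_generator_of_finite_pTorsion (W'.baseChange K) 3 κ 𝔭' ∅ γ Set.finite_empty hfin
  · exact (UniversalToricDescentBetaRoadParamDefs.twinAlgMuZeroAtThreeGoodSSOfParam_iff.mp hC0)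
      W' N' K Dt' hss ha hsurj hN hK hH hodd κ hκ γ 𝔭 h𝔭 he hf 𝔭' h𝔭' hne

/-- The composition applied to the three stubs: the crux BY NAME (sorries only inside `stub_*`). -/
theorem TwinAlgMuZeroAtThree_of_stubs :
    Summit.BirchSwinnertonDyer.BirchSwinnertonDyer.Theses.UniversalToricDescent.TwinAlgMuZeroAtThree :=
  TwinAlgMuZeroAtThree_of stub_avatarExists stub_avatarEngine stub_goodSS

end Summit.BirchSwinnertonDyer.BirchSwinnertonDyer.Cruxes.TwinAlgMuZeroAtThree.WildOrdinaryAvatar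

end
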